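import Mathlib
import Literature.MathematicalPhysics.QuantumFieldTheory.Balaban1983to89.B16Lem381Case2
import Literature.MathematicalPhysics.QuantumFieldTheory.Balaban1983to89.B16Sect1SmallFactors

/-!
# `Balaban1983to89.B16Ineq177Assembly` — [Balaban1989LargeFieldII] (1.77) p. 383 ASSEMBLED from its printed inputs:
the p. 382 first-order display (typed here, `FirstOrder382`), the «local version of (1.7)» letter, and the PROVED
window arithmetic `N(100MN^{β₀}R_j)^d·M⁶R_j ≦ 100^d·M^{d+6}R_j^{d+3}`

T. Bałaban, *Large field renormalization. II. Localization, exponentiation, and bounds for the 𝐑 operation*, Commun.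
Math. Phys. **122** (1989) 355–392 [Balaban1989LargeFieldII] (cell paper B16; PDF held
`paper:balaban1989-cmp122-large-field-ii`, journal page = PDF page + 354; pp. 382–383 = PDF 28–29, RE-READ AS IMAGES by
this seat on the x2 renders `run/shared/lean/pub/pub-balaban/b2b-balaban-ref1/pages/1989-cmp122-large-field-II/…-p028-x2.png`,
`…-p029-x2.png`; the text layer `p0028.txt`/`p0029.txt` garbles the displays).

statement-level skeleton of published theorems with citation tags; proofs where landed; nothing here is a claim about
the Yang–Mills mass gap

CITATION HEADER / WHAT IS REPRODUCED.  Mega-formalization `lit-balaban`, HOME `run/shared/lean/pub/lit-balaban/`;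
reader/typer **r13 gen 14** (B16 display-level owner; rows `lit-balaban-r13/ROWS-B16.md` v2.49).  SKELETON rows
**B16.Eq1.77** (owner r13; typed by r13 gen 1 as the leaf `B16Sect1Kernels.Ineq177 Q ndB γ₀ C A₀ A₁ B₃ B₅ M Rj p₀g p₁g gj d
:= γ₀·ndB − C·A₀A₁²B₃⁴B₅M^{d+6}R_j^{d+3}p₀(g_j)p₁²(g_j)g_j < Q`, p238958; smallness of the constant proved gen 8,
`B16Sect1SmallFactors.ineq177_const_small`), **B16.Lem@381** case 2 (the large-field factor drawn from (1.77)–(1.78):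
`B16Lem381Case2`, r13 gen 7) and the NEW row **B16.Txt@382** = the unnumbered p. 382 display below, found in no row at
this seat's gen-14 audit of pp. 382–389.

THE PRINT (p. 382 foot – p. 383 top [PDF 28–29], verbatim): *«The remaining quadratic form (1.21) is treated in a similar
way as the form in (1.7).  For the field U₀ inside U⁰_{j,Z} we change the gauge again, we fix the axial gauge for M^k(U₀)
on a neighborhood of Z, and then the Landau gauge for U₀ on such a neighborhood.  We obtain (1.83)–(1.87) [IV] with k
replaced by j, and with an additional factor R_j on the right-hand sides.  Next, we fix the Landau gauge for U⁰_{j,Z} on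
Z ∩ Ω″^{~2}_{h+1}, and we get a representation corresponding to (1.87) [IV].  We expand the quadratic form up to the
first order with respect to the corresponding field 𝐀₀.  The first order term can be estimated by
‖B‖²O(1)B₃⁴B₅M⁶R_jε_j < A₁²p₁²(g_j)N(100MN^{β₀}R_j)^dO(1)B₃⁴B₅M⁶R_jA₀p₀(g_j)g_j.
The leading term in the expansion is the quadratic form (1.21) with the minimizer calculated at the external gauge
field equal to 1.  Using the local version of the bound (1.7) we can bound this quadratic form from below by
γ₀ Σ_{p′∈𝔅₀∩Ω″~_{h+1}} |(∂B)(p′)|².  Thus we obtain the inequality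
⟨DH″_{1,j,Z}B, ζDH″_{1,j,Z}B⟩ > γ₀ Σ_{p′∈𝔅₀∩Ω″~_{h+1}} |(∂B)(p′)|² − O(1)A₀A₁²B₃⁴B₅M^{d+6}R_j^{d+3}p₀(g_j)p₁²(g_j)g_j.  (1.77)»*

THE ASSEMBLY (exactly the printed steps, as bookkeeping over the values of the forms at the fixed field `B`):
`Q = Q_lead + E` where `Q_lead` is *«the quadratic form (1.21) with the minimizer calculated at the external gauge field
equal to 1»* and `E` *«the first order term»* of the expansion in `𝐀₀`; the local-(1.7) letter `γ₀·Σ|(∂B)(p′)|² ≦ Q_lead`;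
the display `|E| ≦ ‖B‖²O(1)B₃⁴B₅M⁶R_jε_j < A₁²p₁²(g_j)·N(100MN^{β₀}R_j)^d·O(1)B₃⁴B₅M⁶R_j·A₀p₀(g_j)g_j`; and the ARITHMETIC
that turns the display's right-hand side into the constant of (1.77): `N·(100MN^{β₀}R_j)^d·M⁶R_j = 100^d·N^{1+dβ₀}·M^{d+6}R_j^{d+1}
≦ 100^d·M^{d+6}R_j^{d+3}` because `N^{dβ₀} ≦ N ≦ R_j` (*«We have assumed here that N ≦ R_k»* p. 361 = row B16.Txt@361,
`B16Sect1Kernels.NWindowUpper`, and `dβ₀ ≦ 1` — at `d = 4` the located `4β₀ ≦ 1` of (2.5) [III] used in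
`B16Sect1BoxCounts.cardΓ147_of_box`).  Hence `Q > γ₀Σ|∂B|² − (O(1)·100^d)A₀A₁²B₃⁴B₅M^{d+6}R_j^{d+3}p₀p₁²g_j` = (1.77) with
`O(1) = C·100^d`.

WHAT THIS FILE PROVES (kernel-checked, zero `sorry`; ONE statement-level `def` — the p. 382 display — and theorems;
axioms standard; BY NAME: `B16Sect1Kernels.Ineq177`/`Ineq178`/`NWindowUpper` (r13 gens 1–2),
`B16Lem381Case2.exp_neg_half_form_le`/`c177`/`W178` (r13 gen 7), `B16Sect1SmallFactors.ineq177_const_small` (r13 gen 8) —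
nothing re-proved).
§1 `FirstOrder382` — the p. 382 display typed verbatim (two members: the first-order term against `‖B‖²O(1)B₃⁴B₅M⁶R_jε_j`,
   and the strict bound of the latter).
§2 **`window_arith_382`** — `N·(100·M·N^{β₀}·R_j)^d·(M⁶R_j) ≦ 100^d·M^{d+6}·R_j^{d+3}` for `1 ≦ N ≦ R_j`, `dβ₀ ≦ 1`,
   `0 ≦ M` (PROVED; real powers `N^{β₀}` as printed).
§3 **`ineq177_of_inputs`** — `Ineq177 Q ndB γ₀ (C·100^d) A₀ A₁ B₃ B₅ M R_j p₀g p₁g g_j d` from the splitting `Q = Q_lead + E`,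
   the local-(1.7) letter and `FirstOrder382`; `ineq177_of_firstOrder_bound` — the same from the display's right-hand side
   alone (`|E| <` the printed bound).
§4 `firstOrder382_of_letters` — the display from the evident factorization of its right-hand side (DECLARED READING, not
   used by §3): `‖B‖² <` (number of bond variables)·(A₁p₁(g_j))², the bond count `≦ N(100MN^{β₀}R_j)^d`, `ε_j = g_jA₀p₀(g_j)`
   ((2.4) [III]).
§5 END TO END by name: **`exp_neg_half_form_le_of_inputs`** — the p. 383 large-field mechanism of Lemma@381 case 2
   (`B16Lem381Case2.exp_neg_half_form_le`: (1.77) + (1.78) + a bond with `|B(b)| ≧ A₁p₁(g_j)` ⇒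
   `e^{−½Q} ≦ e^{½c}·exp(−½γ₀W⁻¹A₁²p₁²)`) with (1.77) now SUPPLIED by §3; **`ineq177_lower_of_inputs_small`** — p. 383
   *«We assume that g_j is sufficiently small, so that the constant on the right-hand side above is small, or O(1)»*:
   `Q > γ₀Σ|∂B|² − 1` for `0 < g_j ≦ g₀` from the inputs (gen 8's `ineq177_const_small` at the constant `C·100^d`).
HONEST SCOPE.  Located hypotheses, NOT discharged here (each a printed input of p. 382 in its printed shape, G.5-45 (ii)):
(a) the splitting of `⟨DH″_{1,j,Z}B, ζDH″_{1,j,Z}B⟩` into leading term + first-order term after the gauge fixings and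
the (1.87)[IV]-type representation (`hQ`); (b) the «local version of (1.7)» lower bound of the leading term (`hlead`;
(1.83)–(1.87) [IV] «with k replaced by j, and with an additional factor R_j», Sect. F [15] / Sect. B [13] machinery —
the analytic leaf of row 1.77, as for row 1.7); (c) the display itself (`h382`), whose left member is the first-order
expansion bound and whose right member bounds `‖B‖²ε_j` — §4 records the evident factorization as a reading only
(print does not display the bound on `‖B‖²` separately).  `dβ₀ ≦ 1` is our explicit form of the located `β₀` smallness
((2.5) [III]; at d = 4: `4β₀ ≦ 1`).  The row's head stays at the owner's call (the form is not constructed here).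
NOT summit progress.  Unit `lit-balaban-r13` (literature-prover-lit-balaban-r13-g14-0).
-/

namespace Literature.MathematicalPhysics.QuantumFieldTheory.Balaban1983to89.B16Ineq177Assembly

open Literature.MathematicalPhysics.QuantumFieldTheory.Balaban1983to89
open B16Sect1Kernels

noncomputable section

/-! ## §1. The p. 382 display typed -/

/-- **p. 382 [28], the unnumbered display of the first-order term** (render p028, verbatim): *«We expand the quadratic
form up to the first order with respect to the corresponding field 𝐀₀.  The first order term can be estimated by
‖B‖²O(1)B₃⁴B₅M⁶R_jε_j < A₁²p₁²(g_j)N(100MN^{β₀}R_j)^dO(1)B₃⁴B₅M⁶R_jA₀p₀(g_j)g_j.»* — `E` the first-order term (a real, the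
value at the fixed bond field `B`), `nB = ‖B‖²`, the `O(1)` an explicit `C`, `εj = ε_j`, `p₀g = p₀(g_j)`, `p₁g = p₁(g_j)`,
`N^{β₀}` the real power; factor order as printed. [cite: Balaban1989LargeFieldII, p.382 (before (1.77))] -/
def FirstOrder382 (E nB C B₃ B₅ M Rj εj A₁ p₁g A₀ p₀g gj β₀ : ℝ) (N d : ℕ) : Prop :=
  |E| ≤ nB * (C * B₃ ^ 4 * B₅ * M ^ 6 * Rj * εj) ∧
    nB * (C * B₃ ^ 4 * B₅ * M ^ 6 * Rj * εj) <
      A₁ ^ 2 * p₁g ^ 2 * ((N : ℝ) * (100 * M * (N : ℝ) ^ β₀ * Rj) ^ d) *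
        (C * B₃ ^ 4 * B₅ * M ^ 6 * Rj) * (A₀ * p₀g * gj)

/-- The display bounds the first-order term by its right-hand side. [cite: Balaban1989LargeFieldII, p.382 (before (1.77))] -/
theorem FirstOrder382.abs_lt {E nB C B₃ B₅ M Rj εj A₁ p₁g A₀ p₀g gj β₀ : ℝ} {N d : ℕ}
    (h : FirstOrder382 E nB C B₃ B₅ M Rj εj A₁ p₁g A₀ p₀g gj β₀ N d) :
    |E| < A₁ ^ 2 * p₁g ^ 2 * ((N : ℝ) * (100 * M * (N : ℝ) ^ β₀ * Rj) ^ d) *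
        (C * B₃ ^ 4 * B₅ * M ^ 6 * Rj) * (A₀ * p₀g * gj) :=
  lt_of_le_of_lt h.1 h.2

/-! ## §2. The window arithmetic behind the constant of (1.77) -/

/-- **The arithmetic `N(100MN^{β₀}R_j)^d·M⁶R_j ≦ 100^d M^{d+6} R_j^{d+3}`** that turns the right-hand side of the p. 382
display into the constant of (1.77): `(100MN^{β₀}R_j)^d = 100^d M^d N^{dβ₀} R_j^d`, `N^{dβ₀} ≦ N` (`N ≧ 1`, `dβ₀ ≦ 1`) and
`N ≦ R_j` (*«We have assumed here that N ≦ R_k»*, p. 361 — `B16Sect1Kernels.NWindowUpper`).  PROVED.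
[cite: Balaban1989LargeFieldII, (1.77) p.383] -/
theorem window_arith_382 {M Rj β₀ : ℝ} {N d : ℕ} (hN1 : 1 ≤ N) (hNR : NWindowUpper N Rj)
    (hdβ : (d : ℝ) * β₀ ≤ 1) (hM : 0 ≤ M) :
    (N : ℝ) * (100 * M * (N : ℝ) ^ β₀ * Rj) ^ d * (M ^ 6 * Rj) ≤ 100 ^ d * M ^ (d + 6) * Rj ^ (d + 3) := by
  unfold NWindowUpper at hNR
  have hN1' : (1 : ℝ) ≤ N := by exact_mod_cast hN1
  have hN0 : (0 : ℝ) ≤ N := by positivity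
  have hR1 : 1 ≤ Rj := hN1'.trans hNR
  have hR0 : 0 ≤ Rj := by linarith
  -- `(N^{β₀})^d = N^{β₀ d} ≤ N^1 = N ≤ R_j`
  have hpow : ((N : ℝ) ^ β₀) ^ d ≤ Rj := by
    have e1 : ((N : ℝ) ^ β₀) ^ d = (N : ℝ) ^ (β₀ * d) := by
      rw [← Real.rpow_natCast, ← Real.rpow_mul hN0]
    rw [e1]
    calc (N : ℝ) ^ (β₀ * d) ≤ (N : ℝ) ^ (1 : ℝ) :=
          Real.rpow_le_rpow_of_exponent_le hN1' (by rw [mul_comm]; exact hdβ)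
      _ = N := Real.rpow_one _
      _ ≤ Rj := hNR
  have hpow0 : 0 ≤ ((N : ℝ) ^ β₀) ^ d := pow_nonneg (Real.rpow_nonneg hN0 _) _
  have e2 : (N : ℝ) * (100 * M * (N : ℝ) ^ β₀ * Rj) ^ d * (M ^ 6 * Rj) =
      100 ^ d * M ^ (d + 6) * Rj ^ (d + 1) * ((N : ℝ) * ((N : ℝ) ^ β₀) ^ d) := by
    rw [mul_pow, mul_pow, mul_pow]; ring
  have e3 : (100 : ℝ) ^ d * M ^ (d + 6) * Rj ^ (d + 3) = 100 ^ d * M ^ (d + 6) * Rj ^ (d + 1) * (Rj * Rj) := by ring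
  rw [e2, e3]
  exact mul_le_mul_of_nonneg_left (mul_le_mul hNR hpow hpow0 hR0) (by positivity)

/-! ## §3. (1.77) from the printed steps -/

/-- **(1.77) p. 383 ASSEMBLED from the display's right-hand side**: with the splitting `Q = Q_lead + E` of
`Q = ⟨DH″_{1,j,Z}B, ζDH″_{1,j,Z}B⟩` into *«the quadratic form (1.21) with the minimizer calculated at the external gauge
field equal to 1»* and *«the first order term»*, the local-(1.7) letter `γ₀Σ_{p′∈𝔅₀∩Ω″~_{h+1}}|(∂B)(p′)|² ≦ Q_lead` and the
printed bound `|E| < A₁²p₁²(g_j)N(100MN^{β₀}R_j)^d·C·B₃⁴B₅M⁶R_j·A₀p₀(g_j)g_j`, the window arithmetic of §2 (`1 ≦ N ≦ R_j`,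
`dβ₀ ≦ 1`) gives `Ineq177 Q ndB γ₀ (C·100^d) A₀ A₁ B₃ B₅ M R_j p₀g p₁g g_j d`, i.e. (1.77) with `O(1) = C·100^d`.
[cite: Balaban1989LargeFieldII, (1.77) pp.382–383] -/
theorem ineq177_of_firstOrder_bound {Q Qlead E ndB γ₀ C B₃ B₅ M Rj A₁ p₁g A₀ p₀g gj β₀ : ℝ} {N d : ℕ}
    (hQ : Q = Qlead + E) (hlead : γ₀ * ndB ≤ Qlead)
    (hE : |E| < A₁ ^ 2 * p₁g ^ 2 * ((N : ℝ) * (100 * M * (N : ℝ) ^ β₀ * Rj) ^ d) *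
        (C * B₃ ^ 4 * B₅ * M ^ 6 * Rj) * (A₀ * p₀g * gj))
    (hN1 : 1 ≤ N) (hNR : NWindowUpper N Rj) (hdβ : (d : ℝ) * β₀ ≤ 1) (hM : 0 ≤ M)
    (hC : 0 ≤ C) (hB₅ : 0 ≤ B₅) (hA₀ : 0 ≤ A₀) (hp₀ : 0 ≤ p₀g) (hgj : 0 ≤ gj) :
    Ineq177 Q ndB γ₀ (C * 100 ^ d) A₀ A₁ B₃ B₅ M Rj p₀g p₁g gj d := by
  unfold Ineq177
  have harith := window_arith_382 hN1 hNR hdβ hM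
  -- the common non-negative factor `K = A₁²p₁² · C B₃⁴ B₅ · A₀ p₀ g_j`
  have hB₃ : 0 ≤ B₃ ^ 4 := by positivity
  have hK : 0 ≤ A₁ ^ 2 * p₁g ^ 2 * (C * B₃ ^ 4 * B₅) * (A₀ * p₀g * gj) := by positivity
  have e1 : A₁ ^ 2 * p₁g ^ 2 * ((N : ℝ) * (100 * M * (N : ℝ) ^ β₀ * Rj) ^ d) *
        (C * B₃ ^ 4 * B₅ * M ^ 6 * Rj) * (A₀ * p₀g * gj) =
      A₁ ^ 2 * p₁g ^ 2 * (C * B₃ ^ 4 * B₅) * (A₀ * p₀g * gj) *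
        ((N : ℝ) * (100 * M * (N : ℝ) ^ β₀ * Rj) ^ d * (M ^ 6 * Rj)) := by ring
  have e2 : C * 100 ^ d * A₀ * A₁ ^ 2 * B₃ ^ 4 * B₅ * M ^ (d + 6) * Rj ^ (d + 3) * p₀g * p₁g ^ 2 * gj =
      A₁ ^ 2 * p₁g ^ 2 * (C * B₃ ^ 4 * B₅) * (A₀ * p₀g * gj) * (100 ^ d * M ^ (d + 6) * Rj ^ (d + 3)) := by ring
  have hXY : A₁ ^ 2 * p₁g ^ 2 * ((N : ℝ) * (100 * M * (N : ℝ) ^ β₀ * Rj) ^ d) *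
        (C * B₃ ^ 4 * B₅ * M ^ 6 * Rj) * (A₀ * p₀g * gj) ≤
      C * 100 ^ d * A₀ * A₁ ^ 2 * B₃ ^ 4 * B₅ * M ^ (d + 6) * Rj ^ (d + 3) * p₀g * p₁g ^ 2 * gj := by
    rw [e1, e2]; exact mul_le_mul_of_nonneg_left harith hK
  have hE' := (abs_lt.mp hE).1
  rw [hQ]
  linarith

/-- **(1.77) p. 383 ASSEMBLED from the p. 382 display** (`FirstOrder382`, both members), the splitting and the
local-(1.7) letter: `Ineq177 Q ndB γ₀ (C·100^d) A₀ A₁ B₃ B₅ M R_j p₀g p₁g g_j d`.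
[cite: Balaban1989LargeFieldII, (1.77) pp.382–383] -/
theorem ineq177_of_inputs {Q Qlead E ndB nB γ₀ C B₃ B₅ M Rj εj A₁ p₁g A₀ p₀g gj β₀ : ℝ} {N d : ℕ}
    (hQ : Q = Qlead + E) (hlead : γ₀ * ndB ≤ Qlead)
    (h382 : FirstOrder382 E nB C B₃ B₅ M Rj εj A₁ p₁g A₀ p₀g gj β₀ N d)
    (hN1 : 1 ≤ N) (hNR : NWindowUpper N Rj) (hdβ : (d : ℝ) * β₀ ≤ 1) (hM : 0 ≤ M)
    (hC : 0 ≤ C) (hB₅ : 0 ≤ B₅) (hA₀ : 0 ≤ A₀) (hp₀ : 0 ≤ p₀g) (hgj : 0 ≤ gj) :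
    Ineq177 Q ndB γ₀ (C * 100 ^ d) A₀ A₁ B₃ B₅ M Rj p₀g p₁g gj d :=
  ineq177_of_firstOrder_bound hQ hlead h382.abs_lt hN1 hNR hdβ hM hC hB₅ hA₀ hp₀ hgj

/-! ## §4. The evident factorization of the display's right-hand side (a declared reading) -/

/-- **The p. 382 display from its evident factors** (DECLARED READING — print displays only the product): the
first-order term against `‖B‖²·C·B₃⁴B₅M⁶R_jε_j` (the (1.87)[IV]-type size of `𝐀₀` *«with an additional factor R_j»*),
`‖B‖² <` (number of bond variables)·`(A₁p₁(g_j))²` (`A₁p₁(g_j) = g_j⁻¹δ′_j`, p. 383), the bond count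
`≦ N(100MN^{β₀}R_j)^d`, and the dictionary `ε_j = g_jA₀p₀(g_j)` ((2.4) [III]) give `FirstOrder382 …`.
[cite: Balaban1989LargeFieldII, p.382 (before (1.77)); Balaban1988Convergent, (2.4) p.255] -/
theorem firstOrder382_of_letters {E nB nbonds C B₃ B₅ M Rj εj A₁ p₁g A₀ p₀g gj β₀ : ℝ} {N d : ℕ}
    (hE : |E| ≤ nB * (C * B₃ ^ 4 * B₅ * M ^ 6 * Rj * εj))
    (hB : nB < nbonds * (A₁ * p₁g) ^ 2)
    (hcount : nbonds ≤ (N : ℝ) * (100 * M * (N : ℝ) ^ β₀ * Rj) ^ d)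
    (hε : εj = gj * A₀ * p₀g) (hK : 0 < C * B₃ ^ 4 * B₅ * M ^ 6 * Rj * εj) :
    FirstOrder382 E nB C B₃ B₅ M Rj εj A₁ p₁g A₀ p₀g gj β₀ N d := by
  refine ⟨hE, ?_⟩
  have hsq : 0 ≤ (A₁ * p₁g) ^ 2 := sq_nonneg _
  have h1 : nB * (C * B₃ ^ 4 * B₅ * M ^ 6 * Rj * εj) <
      nbonds * (A₁ * p₁g) ^ 2 * (C * B₃ ^ 4 * B₅ * M ^ 6 * Rj * εj) := mul_lt_mul_of_pos_right hB hK
  have h2 : nbonds * (A₁ * p₁g) ^ 2 * (C * B₃ ^ 4 * B₅ * M ^ 6 * Rj * εj) ≤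
      (N : ℝ) * (100 * M * (N : ℝ) ^ β₀ * Rj) ^ d * (A₁ * p₁g) ^ 2 * (C * B₃ ^ 4 * B₅ * M ^ 6 * Rj * εj) :=
    mul_le_mul_of_nonneg_right (mul_le_mul_of_nonneg_right hcount hsq) hK.le
  have e3 : (N : ℝ) * (100 * M * (N : ℝ) ^ β₀ * Rj) ^ d * (A₁ * p₁g) ^ 2 * (C * B₃ ^ 4 * B₅ * M ^ 6 * Rj * εj) =
      A₁ ^ 2 * p₁g ^ 2 * ((N : ℝ) * (100 * M * (N : ℝ) ^ β₀ * Rj) ^ d) *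
        (C * B₃ ^ 4 * B₅ * M ^ 6 * Rj) * (A₀ * p₀g * gj) := by
    rw [hε]; ring
  linarith [h1, h2, e3.le, e3.ge]

/-! ## §5. End to end by name: the p. 383 large-field mechanism and the smallness clause -/

/-- **Lemma@381, case 2, p. 383, with (1.77) SUPPLIED by the assembly**: *«We take the bond b, for which
|B(b)| ≧ g_j⁻¹δ′_j = A₁p₁(g_j), and the inequalities (1.77), (1.78) yield the following large field factor»* — from the
p. 382 inputs of (1.77) (§3), (1.78) `Ineq178 nb ndB M L N^{β₀} R_j d` and the large bond `(A₁p₁(g_j))² ≦ |B(b)|²`,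
r13 gen 7's `B16Lem381Case2.exp_neg_half_form_le` gives
`e^{−½Q} ≦ e^{½c}·exp(−½γ₀W⁻¹A₁²p₁²(g_j))` with `c = c177 (C·100^d) …` (the (1.77) constant) and
`W = W178 M L N^{β₀} R_j d = 6(d+3)(100M(L+1)N^{β₀}R_j)^{d+2}`.
[cite: Balaban1989LargeFieldII, Lemma p.381 (case 2, pp.382–383)] -/
theorem exp_neg_half_form_le_of_inputs {Q Qlead E ndB nB nb γ₀ C B₃ B₅ M L Rj εj A₁ p₁g A₀ p₀g gj β₀ : ℝ} {N d : ℕ}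
    (hγ : 0 ≤ γ₀) (hW : 0 < 100 * M * (L + 1) * (N : ℝ) ^ β₀ * Rj)
    (hQ : Q = Qlead + E) (hlead : γ₀ * ndB ≤ Qlead)
    (h382 : FirstOrder382 E nB C B₃ B₅ M Rj εj A₁ p₁g A₀ p₀g gj β₀ N d)
    (hN1 : 1 ≤ N) (hNR : NWindowUpper N Rj) (hdβ : (d : ℝ) * β₀ ≤ 1) (hM : 0 ≤ M)
    (hC : 0 ≤ C) (hB₅ : 0 ≤ B₅) (hA₀ : 0 ≤ A₀) (hp₀ : 0 ≤ p₀g) (hgj : 0 ≤ gj)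
    (h78 : Ineq178 nb ndB M L ((N : ℝ) ^ β₀) Rj d) (hb : (A₁ * p₁g) ^ 2 ≤ nb) :
    Real.exp (-(1 / 2) * Q) ≤
      Real.exp (1 / 2 * B16Lem381Case2.c177 (C * 100 ^ d) A₀ A₁ B₃ B₅ M Rj p₀g p₁g gj d) *
        Real.exp (-(1 / 2) * γ₀ * (B16Lem381Case2.W178 M L ((N : ℝ) ^ β₀) Rj d)⁻¹ * A₁ ^ 2 * p₁g ^ 2) :=
  B16Lem381Case2.exp_neg_half_form_le hγ hW
    (ineq177_of_inputs hQ hlead h382 hN1 hNR hdβ hM hC hB₅ hA₀ hp₀ hgj) h78 hb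

/-- **p. 383, *«We assume that g_j is sufficiently small, so that the constant on the right-hand side above is small, or
O(1)»*, from the inputs**: for the constants of the assembly there is `g₀ > 0` such that, for `0 < g_j ≦ g₀` in the
[III] dictionary at scale `j` (`ℓ = log g_j⁻²`, `ℓ^{r₀} ≦ R_j ≦ Lℓ^{r₀}`, `p₀(g_j) = ℓ^{p₀}`, `p₁(g_j) = ℓ^{p₁}`), the
p. 382 inputs give `Q > γ₀Σ_{p′}|(∂B)(p′)|² − 1` (r13 gen 8's `B16Sect1SmallFactors.ineq177_lower_of_small` at the
constant `C·100^d`, fed by §3). [cite: Balaban1989LargeFieldII, (1.77) p.383] -/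
theorem ineq177_lower_of_inputs_small (C A₀ A₁ B₃ B₅ M L p₀ p₁ r₀ : ℝ) (d : ℕ) (hC : 0 ≤ C) (hA₀ : 0 ≤ A₀)
    (hB₅ : 0 ≤ B₅) (hM : 0 ≤ M) :
    ∃ g₀ : ℝ, 0 < g₀ ∧ ∀ (gj ℓ Rj p₀g p₁g γ₀ Q Qlead E ndB nB εj β₀ : ℝ) (N : ℕ), 0 < gj →
      ℓ = Real.log (gj ^ 2)⁻¹ → ℓ ^ r₀ ≤ Rj → Rj ≤ L * ℓ ^ r₀ → gj ≤ g₀ → p₀g = ℓ ^ p₀ → p₁g = ℓ ^ p₁ →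
      Q = Qlead + E → γ₀ * ndB ≤ Qlead → FirstOrder382 E nB C B₃ B₅ M Rj εj A₁ p₁g A₀ p₀g gj β₀ N d →
      1 ≤ N → NWindowUpper N Rj → (d : ℝ) * β₀ ≤ 1 → γ₀ * ndB - 1 < Q := by
  obtain ⟨g₀, hg₀, h⟩ :=
    B16Sect1SmallFactors.ineq177_lower_of_small (C * 100 ^ d) A₀ A₁ B₃ B₅ M L p₀ p₁ r₀ d (by positivity) hA₀ hB₅ hM
  refine ⟨min g₀ 1, lt_min hg₀ one_pos, fun gj ℓ Rj p₀g p₁g γ₀ Q Qlead E ndB nB εj β₀ N hg0 hℓeq hRlo hRhi hg hp₀eq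
    hp₁eq hQ hlead h382 hN1 hNR hdβ => ?_⟩
  -- `g_j ≤ 1` gives `ℓ = log g_j⁻² ≥ 0`, hence `p₀(g_j) = ℓ^{p₀} ≥ 0`
  have hg1 : gj ≤ 1 := hg.trans (min_le_right _ _)
  have hℓ0 : 0 ≤ ℓ := by
    rw [hℓeq]
    refine Real.log_nonneg ?_
    have h2 : gj ^ 2 ≤ 1 := by nlinarith
    exact (one_le_inv₀ (by positivity)).mpr h2
  have hp₀ : 0 ≤ p₀g := by rw [hp₀eq]; exact Real.rpow_nonneg hℓ0 _
  exact h gj ℓ Rj p₀g p₁g γ₀ Q ndB hg0 hℓeq hRlo hRhi (hg.trans (min_le_left _ _)) hp₀eq hp₁eq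
    (ineq177_of_inputs hQ hlead h382 hN1 hNR hdβ hM hC hB₅ hA₀ hp₀ hg0.le)

end

end Literature.MathematicalPhysics.QuantumFieldTheory.Balaban1983to89.B16Ineq177Assembly
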